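import Mathlib.Analysis.SpecialFunctions.Exp
import Literature.Computability.MetaComplexity.PolynomialCalculusSizeDegreeCombine
import HarnessLib

/-!
# Size–degree trade-off for the polynomial calculus, II: the theorem of Impagliazzo–Pudlák–Sgall

THEOREM (proved here; Krajíček 2019, Thm. 16.2.4 attributes it to Impagliazzo, Pudlák and Sgall
1999, whose argument refines Clegg–Edmonds–Impagliazzo 1996; the book states it without proof,
"proved in a way analogous to Theorem 5.4.5", the size–width trade-off for resolution).  In the polynomial calculus
with the variable-multiplication rule in multilinear representation (`MLPC.Derivable` of
`PolynomialCalculusVariableRule.lean`), over any field `K`: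

**`MLPC.derivable_one_lowDegree_of_card_lt`.**  Let `𝓕` be a set of axioms in the variables
`V` (`|V| = n`) of degree `≤ d₀`, let `1 ≤ D ≤ n` and `k ∈ ℕ`.  If `𝓕` has a refutation all of
whose FAT monomials — those with `≥ D` variables — belong to a set `M` with
`|M| · (1 - D/n)^k < 1`, then `𝓕` has a refutation all of whose lines have degree `≤ D + d₀ + k`.

Contrapositive, with the degree bridge to Krajíček's PC/F (`MLPC.Derivable.pc`):

**`MLPC.exp_le_card_of_not_refutableInDegree`.**  If `𝓕` has NO PC/F refutation of degree
`≤ D + d₀ + k + 1` (`PC.RefutableInDegree`), then every multilinear refutation of `𝓕` contains at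
least `(1 - D/n)^{-k} ≥ exp (D k / n)` distinct fat monomials; in particular at least that many
distinct monomials (`MLPC.exp_le_card_monomials`).  With `D = k ≈ (d - d₀)/2` this is the
familiar form "degree `d` is necessary ⟹ `exp(Ω((d - d₀)²/n))` monomials are necessary"
(Krajíček 2019, Thm. 16.2.4 (i), after Impagliazzo–Pudlák–Sgall 1999).

Proof (Clegg–Edmonds–Impagliazzo / Impagliazzo–Pudlák–Sgall): induction on `k`, and for fixed
`k` on the set of variables occurring in `M`.  If `M = ∅` every line has degree `< D`.  Otherwise
some variable `x` lies in at least `D|M|/n` members of `M` (double counting,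
`MLPC.exists_var_many`).  Restricting the refutation by `x := 0` kills those members
(`|M₀| ≤ (1 - D/n)|M|`, induction on `k`), and by the first combination lemma `𝓕` derives `1 - x`
in degree `≤ D + d₀ + k`; restricting by `x := 1` does not increase `M` (`MLPC.descend`,
`|M₁| ≤ |M|`) but removes `x` from its variables (inner induction), and the second combination
lemma replays that refutation inside `𝓕`.

References: R. Impagliazzo, P. Pudlák, J. Sgall, *Lower bounds for the polynomial calculus and
the Gröbner basis algorithm*, Comput. Complexity 8 (1999) 127–144 [ImpagliazzoPudlakSgall1999];
M. Clegg, J. Edmonds, R. Impagliazzo, Proc. 28th STOC (1996) 174–183; J. Krajíček, *Proof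
Complexity* (CUP 2019), Thm. 16.2.4 [KrajicekProofComplexity2019].

Design notes.  SIZE is measured by the finite set of monomials of the refutation (a line property
`g.support ⊆ M`), which lower-bounds every other size measure (number of monomials with
repetitions, symbols); the theorem is stated for the sharper set of FAT monomials.  Variables
outside `V` may occur in a refutation; they are restricted away first
(`derivable_one_of_vars_subset`).  The variant with "divisions" of the variables (Krajíček's
Thm. 16.2.4 (ii), needed for `¬WPHP`) is not treated.
-/

noncomputable section

namespace Literature.Computability.MetaComplexity

open Finset MvPolynomial

variable {σ : Type*} {K : Type*} [Field K]

namespace MLPC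

variable {𝓕 : Set (MvPolynomial σ K)}

/-! ### The induction -/

/-- No fat monomials at all: every line has degree `< D`. [folklore] -/
theorem derivable_degree_of_bigMons_subset_empty {D e : ℕ} (hDe : D ≤ e + 1) {f : MvPolynomial σ K}
    (h : Derivable 𝓕 (fun g => bigMons D g ⊆ ∅) f) :
    Derivable 𝓕 (fun g => g.totalDegree ≤ e) f := by
  refine h.mono fun g hg hP => totalDegree_le_of_ml_eq_self hg fun s hs => ?_
  by_contra hlt
  exact Finset.notMem_empty s (hP (mem_bigMons.2 ⟨hs, by omega⟩))

variable [DecidableEq σ]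

/-- **The inductive core of the trade-off** (for axioms of degree `≤ d₀`, `1 ≤ D ≤ n = |V|`):
for every `k`, every set `W ⊆ V` of variables, every axiom set and every set `M` of fat monomials in
the variables `W` with `|M|(1 - D/n)^k < 1`, a refutation with fat monomials in `M` yields a
refutation of degree `≤ D + d₀ + k`. [Impagliazzo–Pudlák–Sgall 1999; Krajíček 2019, Thm. 16.2.4 (i);
Clegg–Edmonds–Impagliazzo 1996] [cite: KrajicekProofComplexity2019, Thm 16.2.4 (i)] -/
theorem derivable_one_lowDegree_core (V : Finset σ) (D d₀ : ℕ) (hDV : D ≤ V.card) :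
    ∀ (k : ℕ) (W : Finset σ), W ⊆ V → ∀ (𝓕 : Set (MvPolynomial σ K)) (M : Finset (σ →₀ ℕ)),
      (∀ g ∈ 𝓕, g.totalDegree ≤ d₀) → (∀ m ∈ M, m.support ⊆ W) →
      (∀ m ∈ M, D ≤ m.support.card) →
      (M.card : ℝ) * (1 - D / V.card) ^ k < 1 →
      Derivable 𝓕 (fun g => bigMons D g ⊆ M) 1 →
      Derivable 𝓕 (fun g => g.totalDegree ≤ D + d₀ + k) 1 := by
  intro k
  induction k with
  | zero =>
    intro W _ 𝓕 M _ _ _ hcard h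
    have hM : M = ∅ := by
      rw [pow_zero, mul_one] at hcard
      have : M.card < 1 := by exact_mod_cast hcard
      exact Finset.card_eq_zero.1 (by omega)
    subst hM
    exact derivable_degree_of_bigMons_subset_empty (by omega) h
  | succ k ihk =>
    intro W
    induction W using Finset.strongInduction with
    | H W ihW =>
    intro hWV 𝓕 M h0 hMW hMD hcard h
    by_cases hMe : M = ∅
    · subst hMe
      exact derivable_degree_of_bigMons_subset_empty (by omega) h
    have hMne : M.Nonempty := Finset.nonempty_iff_ne_empty.2 hMe
    -- the ratio `t = 1 - D/n` and positivity facts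
    set n : ℕ := V.card with hn
    have hnpos : (0 : ℝ) < n := by
      have : 0 < M.card := Finset.card_pos.2 hMne
      rcases Nat.eq_zero_or_pos n with h0n | h0n
      · -- `n = 0` forces `D = 0`, so the factor is `1` and `|M| < 1`
        exfalso
        have hD0 : D = 0 := by omega
        rw [hD0, Nat.cast_zero, zero_div, sub_zero, one_pow, mul_one] at hcard
        have : M.card < 1 := by exact_mod_cast hcard
        omega
      · exact_mod_cast h0n
    have ht0 : (0 : ℝ) ≤ 1 - D / n := by
      rw [sub_nonneg, div_le_one hnpos]; exact_mod_cast hDV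
    -- `D ≥ 1`: otherwise the factor is `1` and `|M| < 1`
    have hD1 : 1 ≤ D := by
      by_contra hD
      have hD0 : D = 0 := by omega
      rw [hD0, Nat.cast_zero, zero_div, sub_zero, one_pow, mul_one] at hcard
      have : M.card < 1 := by exact_mod_cast hcard
      exact hMe (Finset.card_eq_zero.1 (by omega))
    -- a variable `x ∈ W` in many members of `M`
    have hWne : W.Nonempty := by
      obtain ⟨m, hm⟩ := hMne
      have hpos : 0 < m.support.card := by have := hMD m hm; omega
      obtain ⟨i, hi⟩ := Finset.card_pos.1 hpos
      exact ⟨i, hMW m hm hi⟩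
    obtain ⟨x, hxW, hx⟩ := exists_var_many hMW hMD hWne
    have hWn : W.card ≤ n := Finset.card_le_card hWV
    -- cardinalities of the two descendants of `M`
    set M₀ := M.filter fun m => m x = 0 with hM₀
    set M₁ := descend x D M with hM₁
    have hsplit : M₀.card + (M.filter fun m => m x ≠ 0).card = M.card :=
      Finset.card_filter_add_card_filter_not _
    have hcard₀ : (M₀.card : ℝ) * (1 - D / n) ^ k < 1 := by
      -- `|M₀| ≤ (1 - D/n)|M|`
      have h1 : (D : ℝ) * M.card ≤ n * (M.filter fun m => m x ≠ 0).card := by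
        have : D * M.card ≤ n * (M.filter fun m => m x ≠ 0).card :=
          hx.trans (Nat.mul_le_mul_right _ hWn)
        exact_mod_cast this
      have h2 : (M₀.card : ℝ) ≤ M.card * (1 - D / n) := by
        have h3 : (M₀.card : ℝ) = M.card - (M.filter fun m => m x ≠ 0).card := by
          rw [← hsplit]; push_cast; ring
        rw [h3, mul_sub, mul_one, mul_div_assoc']
        rw [le_sub_comm, sub_sub_cancel, div_le_iff₀ hnpos]
        linarith
      calc (M₀.card : ℝ) * (1 - D / n) ^ k ≤ M.card * (1 - D / n) * (1 - D / n) ^ k :=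
            mul_le_mul_of_nonneg_right h2 (pow_nonneg ht0 k)
        _ = M.card * (1 - D / n) ^ (k + 1) := by ring
        _ < 1 := hcard
    have hcard₁ : (M₁.card : ℝ) * (1 - D / n) ^ (k + 1) < 1 :=
      lt_of_le_of_lt (mul_le_mul_of_nonneg_right (by exact_mod_cast card_descend_le x D M)
        (pow_nonneg ht0 _)) hcard
    -- branch `x := 0`: induction on `k`, then the first combination lemma
    have h𝓕₀ : ∀ g ∈ restrictSet x false 𝓕, g.totalDegree ≤ d₀ :=
      fun g hg => totalDegree_le_of_mem_restrictSet h0 hg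
    have hder₀ : Derivable (restrictSet x false 𝓕) (fun g => bigMons D g ⊆ M₀) 1 := by
      have := h.restrict x false (Q := fun g => bigMons D g ⊆ M₀)
        (fun g _ hP => bigMons_restrictVar_false_subset hP x)
      rwa [map_one] at this
    have hlow₀ := ihk W hWV _ M₀ h𝓕₀ (fun m hm => hMW m (Finset.mem_filter.1 hm).1)
      (fun m hm => hMD m (Finset.mem_filter.1 hm).1) hcard₀ hder₀
    have hX : Derivable 𝓕 (fun g => g.totalDegree ≤ D + d₀ + (k + 1)) (1 - X x) :=
      (derivable_one_sub_X_of_restrict_false x h0 hlow₀).mono fun g _ hg => hg.trans (by omega)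
    -- branch `x := 1`: inner induction (the variable `x` disappears), then the replay lemma
    have h𝓕₁ : ∀ g ∈ restrictSet x true 𝓕, g.totalDegree ≤ d₀ :=
      fun g hg => totalDegree_le_of_mem_restrictSet h0 hg
    have hder₁ : Derivable (restrictSet x true 𝓕) (fun g => bigMons D g ⊆ M₁) 1 := by
      have := h.restrict x true (Q := fun g => bigMons D g ⊆ M₁)
        (fun g hg hP => bigMons_restrictVar_true_subset hg hP x)
      rwa [map_one] at this
    have hlow₁ := ihW (W.erase x) (Finset.erase_ssubset hxW) ((Finset.erase_subset _ _).trans hWV)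
      _ M₁ h𝓕₁ (fun m hm => support_subset_of_mem_descend hMW hm)
      (fun m hm => le_card_of_mem_descend hMD hm) hcard₁ hder₁
    exact (derivable_of_restrict_true x h0 hX hlow₁).mono fun g _ hg => hg.trans (by omega)

/-- Restricting away, one at a time, the variables of `M` outside `V` (they do not occur in the
axioms). [folklore] -/
theorem derivable_one_of_vars_subset {V : Finset σ} (h𝓕V : ∀ g ∈ 𝓕, g.vars ⊆ V) {D : ℕ} :
    ∀ (c : ℕ) (M : Finset (σ →₀ ℕ)), ((M.biUnion fun m => m.support) \ V).card ≤ c →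
      Derivable 𝓕 (fun g => bigMons D g ⊆ M) 1 →
      ∃ M' : Finset (σ →₀ ℕ), M'.card ≤ M.card ∧ (∀ m ∈ M', m.support ⊆ V) ∧
        Derivable 𝓕 (fun g => bigMons D g ⊆ M') 1 := by
  intro c
  induction c with
  | zero =>
    intro M hc h
    refine ⟨M, le_rfl, fun m hm i hi => ?_, h⟩
    by_contra hiV
    have : i ∈ (M.biUnion fun m => m.support) \ V :=
      Finset.mem_sdiff.2 ⟨Finset.mem_biUnion.2 ⟨m, hm, hi⟩, hiV⟩
    rw [Finset.card_eq_zero.1 (Nat.le_zero.1 hc)] at this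
    exact Finset.notMem_empty i this
  | succ c ih =>
    intro M hc h
    by_cases hU : ((M.biUnion fun m => m.support) \ V) = ∅
    · exact ih M (by rw [hU, Finset.card_empty]; exact Nat.zero_le _) h
    obtain ⟨x, hx⟩ := Finset.nonempty_iff_ne_empty.2 hU
    obtain ⟨hxM, hxV⟩ := Finset.mem_sdiff.1 hx
    -- restrict `x := 0`; the axioms do not change
    have hset : restrictSet x false 𝓕 = 𝓕 :=
      restrictSet_eq_self_of_notMem_vars false fun g hg hxg => hxV (h𝓕V g hg hxg)
    set M₀ := M.filter fun m => m x = 0 with hM₀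
    have hder : Derivable 𝓕 (fun g => bigMons D g ⊆ M₀) 1 := by
      have := h.restrict x false (Q := fun g => bigMons D g ⊆ M₀)
        (fun g _ hP => bigMons_restrictVar_false_subset hP x)
      rwa [map_one, hset] at this
    have hsub : ((M₀.biUnion fun m => m.support) \ V) ⊆ ((M.biUnion fun m => m.support) \ V).erase x := by
      intro i hi
      obtain ⟨hi1, hi2⟩ := Finset.mem_sdiff.1 hi
      obtain ⟨m, hm, him⟩ := Finset.mem_biUnion.1 hi1
      obtain ⟨hmM, hmx⟩ := Finset.mem_filter.1 hm
      refine Finset.mem_erase.2 ⟨?_, Finset.mem_sdiff.2 ⟨Finset.mem_biUnion.2 ⟨m, hmM, him⟩, hi2⟩⟩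
      rintro rfl
      exact (Finsupp.mem_support_iff.1 him) hmx
    have hc' : ((M₀.biUnion fun m => m.support) \ V).card ≤ c := by
      have := (Finset.card_le_card hsub).trans (Finset.card_erase_le.trans' le_rfl)
      have h2 := Finset.card_erase_of_mem hx
      have h3 := Finset.card_le_card hsub
      omega
    obtain ⟨M', hM'c, hM'V, hM'd⟩ := ih M₀ hc' hder
    exact ⟨M', hM'c.trans (Finset.card_filter_le _ _), hM'V, hM'd⟩

/-- **Size–degree trade-off (Impagliazzo–Pudlák–Sgall), constructive form.**  Let the axioms
`𝓕` have their variables in `V` (`|V| = n`) and degrees `≤ d₀`, and let `D ≤ n`.  If `𝓕` has a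
multilinear refutation all of whose fat monomials (`≥ D` variables) lie in a set `M` with
`|M|·(1 - D/n)^k < 1`, then `𝓕` has a multilinear refutation with all lines of degree
`≤ D + d₀ + k`. [Impagliazzo–Pudlák–Sgall 1999; Krajíček 2019, Thm. 16.2.4 (i); Krajíček 2019, Thm. 16.2.4]
[cite: KrajicekProofComplexity2019, Thm 16.2.4 (i)] -/
theorem derivable_one_lowDegree_of_card_lt {V : Finset σ} {D d₀ k : ℕ} (hDV : D ≤ V.card)
    (h𝓕V : ∀ g ∈ 𝓕, g.vars ⊆ V) (h0 : ∀ g ∈ 𝓕, g.totalDegree ≤ d₀) {M : Finset (σ →₀ ℕ)}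
    (hcard : (M.card : ℝ) * (1 - D / V.card) ^ k < 1)
    (h : Derivable 𝓕 (fun g => bigMons D g ⊆ M) 1) :
    Derivable 𝓕 (fun g => g.totalDegree ≤ D + d₀ + k) 1 := by
  -- variables outside `V` are restricted away
  obtain ⟨M', hM'c, hM'V, hM'd⟩ := derivable_one_of_vars_subset h𝓕V _ M le_rfl h
  -- keep only the fat members
  set M'' := M'.filter fun m => D ≤ m.support.card with hM''
  have hder : Derivable 𝓕 (fun g => bigMons D g ⊆ M'') 1 :=
    hM'd.mono fun g _ hP s hs => Finset.mem_filter.2 ⟨hP hs, (mem_bigMons.1 hs).2⟩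
  have ht0 : (0 : ℝ) ≤ 1 - D / V.card := by
    rcases Nat.eq_zero_or_pos V.card with h0 | hpos
    · have : D = 0 := by omega
      rw [this, h0]; norm_num
    · rw [sub_nonneg, div_le_one (by exact_mod_cast hpos)]; exact_mod_cast hDV
  have hcard'' : (M''.card : ℝ) * (1 - D / V.card) ^ k < 1 := by
    refine lt_of_le_of_lt (mul_le_mul_of_nonneg_right ?_ (pow_nonneg ht0 k)) hcard
    exact_mod_cast (Finset.card_filter_le _ _).trans hM'c
  exact derivable_one_lowDegree_core V D d₀ hDV k V Finset.Subset.rfl 𝓕 M'' h0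
    (fun m hm => hM'V m (Finset.mem_filter.1 hm).1) (fun m hm => (Finset.mem_filter.1 hm).2)
    hcard'' hder

/-! ### Contrapositive: monomial counts from degree lower bounds -/

/-- **Size–degree trade-off, PC/F form.** Under the hypotheses of
`derivable_one_lowDegree_of_card_lt`, `𝓕` has a PC/F refutation (`PC.RefutableInDegree`,
Krajíček's system) of degree `≤ D + d₀ + k + 1`. [Impagliazzo–Pudlák–Sgall 1999; Krajíček
2019, Thm. 16.2.4] [cite: KrajicekProofComplexity2019, Thm 16.2.4 (i)] -/
theorem refutableInDegree_of_card_lt {V : Finset σ} {D d₀ k : ℕ} (hDV : D ≤ V.card)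
    (h𝓕V : ∀ g ∈ 𝓕, g.vars ⊆ V) (h0 : ∀ g ∈ 𝓕, g.totalDegree ≤ d₀) {M : Finset (σ →₀ ℕ)}
    (hcard : (M.card : ℝ) * (1 - D / V.card) ^ k < 1)
    (h : Derivable 𝓕 (fun g => bigMons D g ⊆ M) 1) :
    PC.RefutableInDegree 𝓕 (D + d₀ + k + 1) :=
  refutableInDegree_of_derivable_one (derivable_one_lowDegree_of_card_lt hDV h𝓕V h0 hcard h)
    fun g hg => (h0 g hg).trans (by omega)

/-- **Many fat monomials are necessary when high degree is necessary**: if `𝓕` (variables in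
`V`, `|V| = n`, degrees `≤ d₀`, `D ≤ n`) has no PC/F refutation of degree `≤ D + d₀ + k + 1`,
then the fat monomials of any multilinear refutation, collected in `M`, satisfy
`1 ≤ |M| (1 - D/n)^k`. [Impagliazzo–Pudlák–Sgall 1999; Krajíček 2019,
Thm. 16.2.4] [cite: KrajicekProofComplexity2019, Thm 16.2.4 (i)] -/
theorem one_le_card_mul_pow {V : Finset σ} {D d₀ k : ℕ} (hDV : D ≤ V.card)
    (h𝓕V : ∀ g ∈ 𝓕, g.vars ⊆ V) (h0 : ∀ g ∈ 𝓕, g.totalDegree ≤ d₀)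
    (hnot : ¬ PC.RefutableInDegree 𝓕 (D + d₀ + k + 1)) {M : Finset (σ →₀ ℕ)}
    (h : Derivable 𝓕 (fun g => bigMons D g ⊆ M) 1) :
    1 ≤ (M.card : ℝ) * (1 - D / V.card) ^ k := by
  by_contra hlt
  exact hnot (refutableInDegree_of_card_lt hDV h𝓕V h0 (lt_of_not_ge hlt) h)

/-- **Exponential form**: under the same hypotheses `exp (D k / n) ≤ |M|`.
[Impagliazzo–Pudlák–Sgall 1999; Krajíček 2019, Thm. 16.2.4]
[cite: KrajicekProofComplexity2019, Thm 16.2.4 (i)] -/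
theorem exp_le_card_of_not_refutableInDegree {V : Finset σ} {D d₀ k : ℕ} (hDV : D ≤ V.card)
    (h𝓕V : ∀ g ∈ 𝓕, g.vars ⊆ V) (h0 : ∀ g ∈ 𝓕, g.totalDegree ≤ d₀)
    (hnot : ¬ PC.RefutableInDegree 𝓕 (D + d₀ + k + 1)) {M : Finset (σ →₀ ℕ)}
    (h : Derivable 𝓕 (fun g => bigMons D g ⊆ M) 1) :
    Real.exp (D * k / V.card) ≤ M.card := by
  have h1 := one_le_card_mul_pow hDV h𝓕V h0 hnot h
  set t : ℝ := 1 - D / V.card with ht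
  have htexp : t ≤ Real.exp (-(D / V.card : ℝ)) := by
    rw [ht]; exact Real.one_sub_le_exp_neg _
  have ht0 : 0 ≤ t := by
    rcases Nat.eq_zero_or_pos V.card with h0 | hpos
    · have : D = 0 := by omega
      rw [ht, this, h0]; norm_num
    · rw [ht, sub_nonneg, div_le_one (by exact_mod_cast hpos)]; exact_mod_cast hDV
  have hpow : t ^ k ≤ Real.exp (-(D * k / V.card : ℝ)) := by
    calc t ^ k ≤ (Real.exp (-(D / V.card : ℝ))) ^ k := pow_le_pow_left₀ ht0 htexp k
      _ = Real.exp (-(D * k / V.card : ℝ)) := by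
          rw [← Real.exp_nat_mul]; congr 1; ring
  have h2 : 1 ≤ (M.card : ℝ) * Real.exp (-(D * k / V.card : ℝ)) :=
    h1.trans (mul_le_mul_of_nonneg_left hpow (Nat.cast_nonneg _))
  have h3 := mul_le_mul_of_nonneg_right h2 (Real.exp_pos (D * k / V.card : ℝ)).le
  rwa [one_mul, mul_assoc, ← Real.exp_add, neg_add_cancel, Real.exp_zero, mul_one] at h3

/-- **Plain monomial count**: if `𝓕` has no PC/F refutation of degree `≤ D + d₀ + k + 1`, every
multilinear refutation of `𝓕` all of whose monomials lie in `M` has `|M| ≥ exp (D k / n)`.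
[Impagliazzo–Pudlák–Sgall 1999; Krajíček 2019, Thm. 16.2.4]
[cite: KrajicekProofComplexity2019, Thm 16.2.4 (i)] -/
theorem exp_le_card_monomials {V : Finset σ} {D d₀ k : ℕ} (hDV : D ≤ V.card)
    (h𝓕V : ∀ g ∈ 𝓕, g.vars ⊆ V) (h0 : ∀ g ∈ 𝓕, g.totalDegree ≤ d₀)
    (hnot : ¬ PC.RefutableInDegree 𝓕 (D + d₀ + k + 1)) {M : Finset (σ →₀ ℕ)}
    (h : Derivable 𝓕 (fun g => g.support ⊆ M) 1) :
    Real.exp (D * k / V.card) ≤ M.card :=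
  exp_le_card_of_not_refutableInDegree hDV h𝓕V h0 hnot
    (h.mono fun _ _ hP => (Finset.filter_subset _ _).trans hP)

end MLPC

end Literature.Computability.MetaComplexity
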